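import Mathlib
import HarnessLib
import Summits.HubbardSuperconductivity.HubbardSuperconductivity.Theorems.KLProgrammeKLRegimeEngineFrameShiftDressingSupFlowMainAliasPos
import Summits.HubbardSuperconductivity.HubbardSuperconductivity.Theorems.KLProgrammeKLRegimeEngineGeneralStepResponseFitArith
import Summits.HubbardSuperconductivity.HubbardSuperconductivity.Theorems.KLProgrammeKLRegimeFlowReadResponseFit
import Summits.HubbardSuperconductivity.HubbardSuperconductivity.Theorems.KLProgrammeKLRegimeEngineIsoTupleV17FDoor

/-!
# K3 gen-8-FLOW (stmt 20437, stub (C), the (B) door at the GENERAL STEP, ONE CALL): «(B)-FIT» in `readResidue_flow_hP`'s currency from the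
# general-step (B) door in position space — `frameResponse_hB_flow_of_pos` (cell gate-hubbard-kl, seat p2 g22)

= k3c3-p1's «(B)-FIT» `…FlowReadResponseFit.frameResponse_hB_of_symbolSizes` (p596448, curve-point form) at scale `n := m` ∘ the reading-point doors
`…FrameShiftReadingPointDoors.readingPoint_below_shells_of_succ_le_nScales` (p601546; the curve point `k_F^{K_{m+1}}θ` has `e_{K_{m+1}} = 0` by
`frameLevel_klFermiPoint` and `|e_{K_m}| ≤ frameDist K_{m+1} K_m` by `abs_eval_sub_le_frameDist`) ∘ the history's frame rate `frameDist_klFlowFrameU_succ_le`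
(`fd := Gfr₀·uPow 0 U·4^{(0−2)m}`, `fd ≤ Λ_m/4` by `fd_le_klScale_div_four` from the envelope door `… ≤ 1/128`) ∘ the general-step (B) door of record in position
currency `…FrameShiftDressingSupFlowMainAliasPos.…_main_add_alias_pos` (p648976) at EACH order `l ≤ 4` ∘ the arithmetic word
`…GeneralStepResponseFitArith.generalRHS_le_fit` (`MAIN + ALIAS + FAR ≤ X_l·U²·4^{(l−2)(m+1)}`), for the steps `m + 1 ≤ n_β` of the (A)+(P) induction
((R111); the last index is `twoLegRead_flow_last_registered_of_pos`, p649639).  This is the general-step twin of p649639: the E1 side is FIVE β-free graded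
constant families — `cN l` (pinned weighted `L¹` norm of `W₄[𝒢_t]`, weight order `l ≤ 4`, `≤ cN l·U·(4^m)ˡ`), `cS l`/`cSs` (`W₂[𝒢_t]`, orders `l` and `s`:
`≤ cS l·U·(4^m)ˡ`, `≤ cSs·U·(4^m)ˢ`), `cE l`/`cEs` (`W₂[𝒢̃₁]`: `≤ cE l·U·(4^m)ˡ`, `≤ cEs·U·(4^m)ˢ`), `30 ≤ s` (`𝒢_t` = the action interpolating from the
one-shot action `𝒱^{(m)}[K_m]` at `t = 0` to its dressed representation, `𝒢̃₁` = the dressed-covariance action; texts verbatim from p648976) — and the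
(B) BUDGET WORD is explicit: the output holds for ANY scale-free table `μc ≥ 0` with
  `2^32/4ˡ·Gfr₀·cN l + (Rsq⁴·(cS l² + cE l + 1) + (cSs² + cEs + 1))/2^200 ≤ μc l`   (`l ≤ 4`)
(the MAIN group `fd·Np` carries exactly `U²`; alias and far groups are `U`/`β`-suppressed).  Closer-side inputs carried verbatim: the regime
(`c ≤ klCurveC3 R`, `U ≤ klCurveU0 R ⊓ 1`, `klBetaMin ≤ β ≤ e^{c/U²}`, `μ ∈ klWindowC`), `FrameOK` of `K_m` (any depth) and of `K_{m+1}` (depth `N ≤ m+1`),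
the partition-function units `hZ₂/hZ`, the flow history `hP/hTJ`, the closed envelopes + door `≤ 1/128`, `klEngL₄ ≤ L`.
OUTPUT = the LITERAL `(hBdiff, hB)` pair of `twoLegReadPriv_flow_succ` (p598604) at scale `m` with k3c3-p1's tables `eB = (0, readJetC μc ·)`,
`eB′ = (μc 0, readJetC′ R μc ·)` (`eB 0 = 0`).

* **`frameResponse_hB_flow_of_pos`**.

Composition only; no definitions; nothing asserts any stub of 20437, K3, the margin or superconductivity.  References: BGM 2006 §2.3 (2.21)–(2.24), §2.4
Lemma 2.1 (2.36)–(2.42) [cite: BenfattoGiulianiMastropietro2006]; FST 1996 §1 [cite: FeldmanSalmhoferTrubowitz1996].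
-/

noncomputable section

namespace Summit.HubbardSuperconductivity.HubbardSuperconductivity.Theorems.EngineV8

set_option linter.dupNamespace false -- summit = problem name (single-conjunct summit), D-0017
set_option exponentiation.threshold 1024 -- `2^200`, `2^218` literals in the arithmetic word

open Complex Real Finset Filter Literature.MathematicalPhysics.QuantumLattice Literature.Probability.LatticeModels GrassmannAlgebra
open Literature.MathematicalPhysics.QuantumLattice.BandSectorCounting
open Summit.HubbardSuperconductivity.HubbardSuperconductivity.Theorems.KLRegimeSplit
open Summit.HubbardSuperconductivity.HubbardSuperconductivity.Theorems.DispersionFlow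
open Summit.HubbardSuperconductivity.HubbardSuperconductivity.Theorems.KLProgrammeLegKernels
open Summit.HubbardSuperconductivity.HubbardSuperconductivity.Theorems.PerturbedFermiCurve
open scoped Nat

section GeneralOfPos

variable {L M : ℕ} [NeZero L] [NeZero M]

/-- **«(B)-FIT» AT THE GENERAL STEP FROM THE POSITION-SPACE DOOR, ONE CALL** — see the module docstring.
[cite: BenfattoGiulianiMastropietro2006, §2.4 Lemma 2.1 (2.36)–(2.42)] -/
theorem frameResponse_hB_flow_of_pos {R : RenConsts} (hR : ∀ j, 0 ≤ R.Gfr j) {c : ℝ} (hc : 0 < c) (hcle : c ≤ klCurveC3 R)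
    {U : ℝ} (hU : 0 < U) (hU1 : U ≤ 1) (hUle : U ≤ klCurveU0 R) {β : ℝ} (hβmin : klBetaMin ≤ β) (hβc : β ≤ Real.exp (c / U ^ 2))
    {μ : ℝ} (hμ : μ ∈ klWindowC) (m : ℕ) (hm1 : m + 1 ≤ nScales β)
    {G : GeoConsts} {Q : EngConsts} (hGS : ∀ k, 0 ≤ G.S k) (hQS : ∀ k, 0 ≤ Q.S' k)
    {Nf₁ N : ℕ} (hOK₁ : FrameOK R U Nf₁ μ (klFlowFrameU L M β U μ m)) (hOK₂ : FrameOK R U N μ (klFlowFrameU L M β U μ (m + 1))) (hNn : N ≤ m + 1)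
    (hZ₂ : IsUnit (effPartitionFn ℂ (normalCovariance L M (uvSymbolCT L M β μ (klFlowFrameU L M β U μ (m + 1)) (klScale klE0 m))) (hubbardInteraction L M β U + counterQuadratic L M β (klFlowFrameU L M β U μ (m + 1)))))
    (hZ : ∀ t ∈ Set.Icc (0 : ℝ) 1, effPartitionFn ℂ
      (normalCovariance L M (uvSymbolCT L M β μ (klFlowFrameU L M β U μ m) (klScale klE0 m)) + ((t : ℂ)) • (normalCovariance L M (fun ks => uvSymbolCT L M β μ (klFlowFrameU L M β U μ (m + 1)) (klScale klE0 m) ks / (1 + uvSymbolCT L M β μ (klFlowFrameU L M β U μ (m + 1)) (klScale klE0 m) ks * (((fsub (klFlowFrameU L M β U μ (m + 1)) (klFlowFrameU L M β U μ m)).eval (latticeMomentum L ks.1.2) / (β * (L : ℝ) ^ 2) : ℝ) : ℂ))) - normalCovariance L M (uvSymbolCT L M β μ (klFlowFrameU L M β U μ m) (klScale klE0 m)))) (hubbardInteraction L M β U + counterQuadratic L M β (klFlowFrameU L M β U μ m)) ≠ 0)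
    -- the flow history and the closed envelopes (verbatim from the door)
    {n : ℕ} (hP : ∀ m' ≤ n, FlowPieceJetsAt L M β U μ R m') (hTJ : ∀ m' ≤ n, TwoLegReadJetsF L M G Q β U μ m') (hmn : m ≤ n)
    (hR0 : 0 < R.Gfr 0) {W Ξ Θ : ℝ} (hW : W = curveExtC (8 * 576 * (342 : ℝ) ^ 4) G.S 1 + curveExtC (8 * 576 * (342 : ℝ) ^ 4) Q.S' 1 * |U|)
    (hΞ : Ξ = (2 ^ 10 * (1 + Real.pi ^ 8 * (W * U ^ 2) / 2 ^ 11) + ∑ j ∈ range 5, R.Gfr j))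
    (hΘ : Θ = (1 + ((∑ j ∈ range 5, R.Gfr j) + Real.pi ^ 8 * W / 2 ^ 11) * |U| / R.Gfr 0))
    (hdoor : R.Gfr 0 * |U| + ((∑ j ∈ range 5, R.Gfr j) + Real.pi ^ 8 * W / 2 ^ 11) * U ^ 2 ≤ 1 / 128) {P : SplitConsts} (hL : klEngL₄ P R β U ≤ L)
    {s : ℕ} (hs : 30 ≤ s)
    -- E1: five β-free graded constant families
    {cN cS cE : ℕ → ℝ} {cSs cEs : ℝ} (hcN : ∀ l, 0 ≤ cN l) (hcS : ∀ l, 0 ≤ cS l) (hcE : ∀ l, 0 ≤ cE l) (hcSs : 0 ≤ cSs) (hcEs : 0 ≤ cEs)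
    (hNp : ∀ l ≤ 4, ∀ t ∈ Set.Icc (0 : ℝ) 1, ∀ (σ : Fin 2) (A : HubbardFieldIdx L M) (x₀ : SpaceTimeIdx L M), imagTimeWeight β M ^ 3 *
      ∑ x ∈ (univ : Finset (Fin 4 → SpaceTimeIdx L M)).filter (fun x => x 0 = x₀),
        (1 + ((((x 1).2 - (x 0).2) 0).valMinAbs.natAbs : ℝ) + ((((x 1).2 - (x 0).2) 1).valMinAbs.natAbs : ℝ)) ^ l *
          ‖sectorisedKernel L M β (trivialMultiplier L M)
            (effAction ℂ (normalCovariance L M (uvSymbolCT L M β μ (klFlowFrameU L M β U μ m) (klScale klE0 m)) + ((t : ℂ)) • (normalCovariance L M (fun ks => uvSymbolCT L M β μ (klFlowFrameU L M β U μ (m + 1)) (klScale klE0 m) ks / (1 + uvSymbolCT L M β μ (klFlowFrameU L M β U μ (m + 1)) (klScale klE0 m) ks * (((fsub (klFlowFrameU L M β U μ (m + 1)) (klFlowFrameU L M β U μ m)).eval (latticeMomentum L ks.1.2) / (β * (L : ℝ) ^ 2) : ℝ) : ℂ))) - normalCovariance L M (uvSymbolCT L M β μ (klFlowFrameU L M β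 U μ m) (klScale klE0 m)))) (hubbardInteraction L M β U + counterQuadratic L M β (klFlowFrameU L M β U μ m))) 4
            (![((0, σ), 0), ((0, σ), 1), ((0, A.1.2), 1 - A.2), ((0, A.1.2), A.2)] : Fin 4 → SectorLeg 1) x‖ ≤ cN l * U * ((4 : ℝ) ^ m) ^ l)
    (hSp : ∀ l ≤ 4, ∀ t ∈ Set.Icc (0 : ℝ) 1, ∀ (σ : Fin 2) (x₀ : SpaceTimeIdx L M),
      (imagTimeWeight β M * ∑ x ∈ (univ : Finset (Fin 2 → SpaceTimeIdx L M)).filter (fun x => x 0 = x₀),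
        (1 + ((((x 1).2 - (x 0).2) 0).valMinAbs.natAbs : ℝ) + ((((x 1).2 - (x 0).2) 1).valMinAbs.natAbs : ℝ)) ^ l *
          ‖sectorisedKernel L M β (trivialMultiplier L M)
            (effAction ℂ (normalCovariance L M (uvSymbolCT L M β μ (klFlowFrameU L M β U μ m) (klScale klE0 m)) + ((t : ℂ)) • (normalCovariance L M (fun ks => uvSymbolCT L M β μ (klFlowFrameU L M β U μ (m + 1)) (klScale klE0 m) ks / (1 + uvSymbolCT L M β μ (klFlowFrameU L M β U μ (m + 1)) (klScale klE0 m) ks * (((fsub (klFlowFrameU L M β U μ (m + 1)) (klFlowFrameU L M β U μ m)).eval (latticeMomentum L ks.1.2) / (β * (L : ℝ) ^ 2) : ℝ) : ℂ))) - normalCovariance L M (uvSymbolCT L M β μ (klFlowFrameU L M β U μ m) (klScale klE0 m)))) (hubbardInteraction L M β U + counterQuadratic L M β (klFlowFrameU L M β U μ m))) 2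
            (![((0, σ), 0), ((0, σ), 1)] : Fin 2 → SectorLeg 1) x‖ ≤ cS l * U * ((4 : ℝ) ^ m) ^ l))
    (hSps : ∀ t ∈ Set.Icc (0 : ℝ) 1, ∀ (σ : Fin 2) (x₀ : SpaceTimeIdx L M),
      (imagTimeWeight β M * ∑ x ∈ (univ : Finset (Fin 2 → SpaceTimeIdx L M)).filter (fun x => x 0 = x₀),
        (1 + ((((x 1).2 - (x 0).2) 0).valMinAbs.natAbs : ℝ) + ((((x 1).2 - (x 0).2) 1).valMinAbs.natAbs : ℝ)) ^ s *
          ‖sectorisedKernel L M β (trivialMultiplier L M)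
            (effAction ℂ (normalCovariance L M (uvSymbolCT L M β μ (klFlowFrameU L M β U μ m) (klScale klE0 m)) + ((t : ℂ)) • (normalCovariance L M (fun ks => uvSymbolCT L M β μ (klFlowFrameU L M β U μ (m + 1)) (klScale klE0 m) ks / (1 + uvSymbolCT L M β μ (klFlowFrameU L M β U μ (m + 1)) (klScale klE0 m) ks * (((fsub (klFlowFrameU L M β U μ (m + 1)) (klFlowFrameU L M β U μ m)).eval (latticeMomentum L ks.1.2) / (β * (L : ℝ) ^ 2) : ℝ) : ℂ))) - normalCovariance L M (uvSymbolCT L M β μ (klFlowFrameU L M β U μ m) (klScale klE0 m)))) (hubbardInteraction L M β U + counterQuadratic L M β (klFlowFrameU L M β U μ m))) 2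
            (![((0, σ), 0), ((0, σ), 1)] : Fin 2 → SectorLeg 1) x‖ ≤ cSs * U * ((4 : ℝ) ^ m) ^ s))
    (hSEp : ∀ l ≤ 4, ∀ (σ : Fin 2) (x₀ : SpaceTimeIdx L M),
      (imagTimeWeight β M * ∑ x ∈ (univ : Finset (Fin 2 → SpaceTimeIdx L M)).filter (fun x => x 0 = x₀),
        (1 + ((((x 1).2 - (x 0).2) 0).valMinAbs.natAbs : ℝ) + ((((x 1).2 - (x 0).2) 1).valMinAbs.natAbs : ℝ)) ^ l *
          ‖sectorisedKernel L M β (trivialMultiplier L M)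
            (effAction ℂ (normalCovariance L M (fun ks => uvSymbolCT L M β μ (klFlowFrameU L M β U μ (m + 1)) (klScale klE0 m) ks / (1 + uvSymbolCT L M β μ (klFlowFrameU L M β U μ (m + 1)) (klScale klE0 m) ks * (((fsub (klFlowFrameU L M β U μ (m + 1)) (klFlowFrameU L M β U μ m)).eval (latticeMomentum L ks.1.2) / (β * (L : ℝ) ^ 2) : ℝ) : ℂ)))) (hubbardInteraction L M β U + counterQuadratic L M β (klFlowFrameU L M β U μ m))) 2
            (![((0, σ), 0), ((0, σ), 1)] : Fin 2 → SectorLeg 1) x‖ ≤ cE l * U * ((4 : ℝ) ^ m) ^ l))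
    (hSEs : ∀ (σ : Fin 2) (x₀ : SpaceTimeIdx L M),
      (imagTimeWeight β M * ∑ x ∈ (univ : Finset (Fin 2 → SpaceTimeIdx L M)).filter (fun x => x 0 = x₀),
        (1 + ((((x 1).2 - (x 0).2) 0).valMinAbs.natAbs : ℝ) + ((((x 1).2 - (x 0).2) 1).valMinAbs.natAbs : ℝ)) ^ s *
          ‖sectorisedKernel L M β (trivialMultiplier L M)
            (effAction ℂ (normalCovariance L M (fun ks => uvSymbolCT L M β μ (klFlowFrameU L M β U μ (m + 1)) (klScale klE0 m) ks / (1 + uvSymbolCT L M β μ (klFlowFrameU L M β U μ (m + 1)) (klScale klE0 m) ks * (((fsub (klFlowFrameU L M β U μ (m + 1)) (klFlowFrameU L M β U μ m)).eval (latticeMomentum L ks.1.2) / (β * (L : ℝ) ^ 2) : ℝ) : ℂ)))) (hubbardInteraction L M β U + counterQuadratic L M β (klFlowFrameU L M β U μ m))) 2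
            (![((0, σ), 0), ((0, σ), 1)] : Fin 2 → SectorLeg 1) x‖ ≤ cEs * U * ((4 : ℝ) ^ m) ^ s))
    -- the (B) budget word
    {μc : ℕ → ℝ} (hμc0 : ∀ l, 0 ≤ μc l)
    (hμc : ∀ l ≤ 4, 2 ^ 32 / 4 ^ l * R.Gfr 0 * cN l + (klEngRsq R ^ 4 * (cS l ^ 2 + cE l + 1) + (cSs ^ 2 + cEs + 1)) / 2 ^ 200 ≤ μc l) :
    ContDiff ℝ 4 (fun θ : ℝ =>
      (symInterp L (fun k => klLocSelfEnergyRe L M β U μ (klFlowFrameU L M β U μ (m + 1)) m k -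
            (klFlowFrameU L M β U μ (m + 1)).eval (latticeMomentum L k))).eval (klFermiPoint μ (klFlowFrameU L M β U μ (m + 1)) θ) -
        (symInterp L (fun k => klLocSelfEnergyRe L M β U μ (klFlowFrameU L M β U μ m) m k -
            (klFlowFrameU L M β U μ m).eval (latticeMomentum L k))).eval (klFermiPoint μ (klFlowFrameU L M β U μ (m + 1)) θ)) ∧
    ∀ k ≤ 4, ∀ θ : ℝ, |iteratedDeriv k (fun θ : ℝ =>
      (symInterp L (fun k => klLocSelfEnergyRe L M β U μ (klFlowFrameU L M β U μ (m + 1)) m k -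
            (klFlowFrameU L M β U μ (m + 1)).eval (latticeMomentum L k))).eval (klFermiPoint μ (klFlowFrameU L M β U μ (m + 1)) θ) -
        (symInterp L (fun k => klLocSelfEnergyRe L M β U μ (klFlowFrameU L M β U μ m) m k -
            (klFlowFrameU L M β U μ m).eval (latticeMomentum L k))).eval (klFermiPoint μ (klFlowFrameU L M β U μ (m + 1)) θ)) θ| ≤
      curveJetBar (fun k => if k = 0 then 0 else readJetC μc k) (fun k => if k = 0 then μc 0 else readJetC' R μc k) U k (m + 1) := by
  have hβ0 : 0 < β := pos_of_klBetaMin_le hβmin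
  have hNβ : N ≤ nScales β := hNn.trans hm1
  have hmβ : m ≤ nScales β + 1 := by omega
  -- the envelope door gives `Gfr₀|U| ≤ 1/128`, hence the frame rate is below `Λ_m/4`
  have hW0 : 0 ≤ W := by
    rw [hW]
    exact add_nonneg (curveExtC_nonneg (by norm_num) hGS 1) (mul_nonneg (curveExtC_nonneg (by norm_num) hQS 1) (abs_nonneg U))
  have hG128 := gfr0_abs_le_of_hdoor hR hW0 hdoor
  have hPm : ∀ m' < m + 1, FlowPieceJetsAt L M β U μ R m' := fun m' hm' => hP m' (by omega)
  have hfdist := frameDist_klFlowFrameU_succ_le (L := L) (M := M) (β := β) (U := U) (μ := μ) (R := R) (j := m) hPm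
  have hfd := fd_le_klScale_div_four (hR 0) hG128 m
  -- the curve of the new flow frame: its points are ON the new curve and within the frame distance of the old one
  have hK' : FrameOK R U (nScales β) μ (klFlowFrameU L M β U μ (m + 1)) := FrameOK.mono hR hNβ hOK₂
  obtain ⟨hAf, -, -, -, ⟨hlo, hhi⟩, -, -⟩ := frame_sizes_of_frameOK_explicit hR hc hcle hU hUle hβmin hβc hμ hK'
  have hcurve : ∀ θ : ℝ, frameLevel μ (klFlowFrameU L M β U μ (m + 1)) (WithLp.toLp 2 (klFermiPoint μ (klFlowFrameU L M β U μ (m + 1)) θ)) = 0 :=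
    fun θ => frameLevel_klFermiPoint (bandBounds (show (-4 : ℝ) < -1.1 by norm_num) (show (-1.1 : ℝ) ≤ -0.1 by norm_num) (show (-0.1 : ℝ) < 0 by norm_num))
      hAf hlo hhi θ
  have hold : ∀ θ : ℝ, |frameLevel μ (klFlowFrameU L M β U μ m) (WithLp.toLp 2 (klFermiPoint μ (klFlowFrameU L M β U μ (m + 1)) θ))| ≤ klScale klE0 m / 4 := by
    intro θ
    have e : frameLevel μ (klFlowFrameU L M β U μ m) (WithLp.toLp 2 (klFermiPoint μ (klFlowFrameU L M β U μ (m + 1)) θ)) =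
        (klFlowFrameU L M β U μ (m + 1)).eval (klFermiPoint μ (klFlowFrameU L M β U μ (m + 1)) θ) -
          (klFlowFrameU L M β U μ m).eval (klFermiPoint μ (klFlowFrameU L M β U μ (m + 1)) θ) := by
      have h := hcurve θ
      simp only [frameLevel] at h ⊢
      linarith
    rw [e]
    exact ((abs_eval_sub_le_frameDist _ _ _).trans hfdist).trans hfd
  have hq : ∀ θ : ℝ,
      ((Real.pi / β) ^ 2 + frameLevel μ (klFlowFrameU L M β U μ (m + 1)) (WithLp.toLp 2 (klFermiPoint μ (klFlowFrameU L M β U μ (m + 1)) θ)) ^ 2 <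
          (klScale klE0 m) ^ 2 / 4) ∧
        ((Real.pi / β) ^ 2 + frameLevel μ (klFlowFrameU L M β U μ m) (WithLp.toLp 2 (klFermiPoint μ (klFlowFrameU L M β U μ (m + 1)) θ)) ^ 2 <
          (klScale klE0 m) ^ 2 / 4) :=
    fun θ => readingPoint_below_shells_of_succ_le_nScales hβmin hm1 (hcurve θ) (hold θ)
  -- the frame rate in the arithmetic word's currency
  have hfd0 : 0 ≤ R.Gfr 0 * uPow 0 U * (4 : ℝ) ^ ((((0 : ℕ) : ℤ) - 2) * (m : ℤ)) :=
    mul_nonneg (mul_nonneg (hR 0) (uPow_nonneg 0 U)) (zpow_nonneg (by norm_num) _)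
  have hfdlaw : R.Gfr 0 * uPow 0 U * (4 : ℝ) ^ ((((0 : ℕ) : ℤ) - 2) * (m : ℤ)) ≤ R.Gfr 0 * U * (((4 : ℝ) ^ m) ^ 2)⁻¹ := by
    rw [uPow_zero, abs_of_pos hU, fd_zpow_eq]
  -- per order `l ≤ 4`: the door, then the arithmetic word, then the budget word
  have hrow : ∀ l ≤ 4, ∀ θ : ℝ, ‖iteratedFDeriv ℝ l (evalM (symInterp L (fun kv : TorusSite 2 L =>
        klLocSelfEnergyRe L M β U μ (klFlowFrameU L M β U μ (m + 1)) m kv - klLocSelfEnergyRe L M β U μ (klFlowFrameU L M β U μ m) m kv - (fsub (klFlowFrameU L M β U μ (m + 1)) (klFlowFrameU L M β U μ m)).eval (latticeMomentum L kv))))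
      (WithLp.toLp 2 (klFermiPoint μ (klFlowFrameU L M β U μ (m + 1)) θ))‖ ≤ μc l * U ^ 2 * (4 : ℝ) ^ (((l : ℤ) - 2) * ((m + 1 : ℕ) : ℤ)) := by
    intro l hl θ
    have hcNl := hcN l; have hcSl := hcS l; have hcEl := hcE l
    have hNp0 : 0 ≤ cN l * U * ((4 : ℝ) ^ m) ^ l := by positivity
    have hd := norm_iteratedFDeriv_klLocSelfEnergyRe_flowFrame_sub_le_main_add_alias_pos hβmin hU hU1 μ m hR hGS hQS hμ hOK₁ hOK₂ hfdist hfd hZ₂ hZ l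
      (WithLp.toLp 2 (klFermiPoint μ (klFlowFrameU L M β U μ (m + 1)) θ)) hNp0 (hNp l hl) (hq θ).1 (hq θ).2 hs hl
      (Spj := cS l * U * ((4 : ℝ) ^ m) ^ l) (Sps := cSs * U * ((4 : ℝ) ^ m) ^ s) (SEj := cE l * U * ((4 : ℝ) ^ m) ^ l) (SEs := cEs * U * ((4 : ℝ) ^ m) ^ s)
      (Nj := cS l * U * ((4 : ℝ) ^ m) ^ l) (Ns := cSs * U) (Nj' := 2 * (cE l * U * ((4 : ℝ) ^ m) ^ l)) (Ns' := 2 * (cEs * U))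
      (fun t ht σ x₀ => ⟨hSp l hl t ht σ x₀, hSps t ht σ x₀⟩) (fun σ x₀ => ⟨hSEp l hl σ x₀, hSEs σ x₀⟩)
      hP hTJ hmn hR0 hW hΞ hΘ hdoor hL hmβ le_rfl le_rfl le_rfl (le_of_eq (by ring))
    have ha := generalRHS_le_fit P R (l := l) hβmin hm1 hU hU1 hL hl hfd0 hfdlaw (hR 0) hNp0 le_rfl (by positivity) le_rfl le_rfl
      (by positivity) le_rfl le_rfl hcNl hcSl hcEl hcSs hcEs
    have hz : 0 ≤ U ^ 2 * (4 : ℝ) ^ (((l : ℤ) - 2) * ((m + 1 : ℕ) : ℤ)) := mul_nonneg (sq_nonneg U) (zpow_nonneg (by norm_num) _)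
    calc _ ≤ _ := hd
      _ ≤ _ := ha
      _ ≤ μc l * (U ^ 2 * (4 : ℝ) ^ (((l : ℤ) - 2) * ((m + 1 : ℕ) : ℤ))) := mul_le_mul_of_nonneg_right (hμc l hl) hz
      _ = μc l * U ^ 2 * (4 : ℝ) ^ (((l : ℤ) - 2) * ((m + 1 : ℕ) : ℤ)) := by ring
  refine frameResponse_hB_of_symbolSizes hR hc hcle hU hUle hU1 hβmin hβc hμ hOK₂ hNn hNβ hμc0 (fun θ => ?_) (fun θ l hl1 hl4 => hrow l hl4 θ)
  have h := hrow 0 (by norm_num) θ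
  rwa [norm_iteratedFDeriv_zero, Real.norm_eq_abs] at h

end GeneralOfPos

end Summit.HubbardSuperconductivity.HubbardSuperconductivity.Theorems.EngineV8

end
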